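import Literature.NumberTheory.EllipticCurves.ModularSymbolsManin
import Literature.NumberTheory.EllipticCurves.ModularCurveGenusProofs
import Literature.NumberTheory.EllipticCurves.ModularCurveSturmProofs
import HarnessLib

/-!
# `dim S₂(Γ₀(N)) ≤ g(X₀(N))` in closed form, the genus-zero levels, and the named fact
  `twelve_mul_finrank_cuspForm_two (Γ₀(N))` for `g(X₀(N)) = 0`
  (trunk EllArithM, item C17; assembly)

`ModularSymbolsManin.twelve_mul_finrank_cuspForm_two_add_le` proves, by Manin's modular symbols
and the injectivity of periods, the inequality
`12 dim S₂(Γ₀(N)) + 3ε₂ + 4ε₃ + 6ε_∞ ≤ 12 + [SL₂(ℤ) : Γ₀(N)]` for every `N ≥ 1` — the `≤` half of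
the named fact `twelve_mul_finrank_cuspForm_two (Gamma0 N)` of `ModularCurveProofs`
(Diamond–Shurman Thm. 3.1.1 with Thm. 3.5.1). With the landed counts
`ε₂ = ν₂`, `ε₃ = ν₃` (`ModularCurveEllipticPointsProofs`), `ε_∞ = ν_∞` (`ModularCurveCuspsProofs`)
and `[SL₂(ℤ) : Γ₀(N)] = μ` (`ModularCurveGamma0IndexProofs`) this file records:

* `twelve_mul_finrank_cuspForm_two_add_le_gamma0Index`:
  `12 dim S₂(Γ₀(N)) + 3ν₂ + 4ν₃ + 6ν_∞ ≤ 12 + μ`, and **`dim S₂(Γ₀(N)) ≤ g(X₀(N))` for all `N`**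
  in terms of the closed formula `genusX0 N` (`finrank_cuspForm_two_le_genusX0`);
* hence the named fact `finrank_cuspForm_two_eq_genusX0 N` (`dim = g`) **for every `N` with
  `genusX0 N = 0`** (`finrank_cuspForm_two_eq_genusX0_of_genusX0_eq_zero`) — in particular for
  `N = 13` (`finrank_cuspForm_two_eq_genusX0_thirteen`), the genus-zero level not reached by the
  Sturm bound of `ModularCurveSturmProofs` (two elliptic points of each period) — and for every `N`
  with `genusX0 N = 1` carrying a nonzero weight-`2` cusp form
  (`finrank_cuspForm_two_eq_genusX0_of_genusX0_eq_one`);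
* what is left of the deep fact: `twelve_mul_finrank_cuspForm_two (Gamma0 N)` is **equivalent to
  the lower bound** `12 + μ ≤ 12 dim S₂(Γ₀(N)) + 3ν₂ + 4ν₃ + 6ν_∞`, i.e. to the existence of
  `g(X₀(N))` linearly independent cusp forms (Riemann–Roch)
  (`twelve_mul_finrank_cuspForm_two_gamma0_iff_le`), and it **holds for every `N` for which
  `finrank_cuspForm_two_eq_genusX0 N` and the exactness `twelve_mul_genusX0 N` are known**
  (`twelve_mul_finrank_cuspForm_two_gamma0_of`): for the fifteen genus-zero levels
  `N ∈ {1, …, 10, 12, 13, 16, 18, 25}` (`twelve_mul_finrank_cuspForm_two_gamma0_of_mem`), where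
  `12 + μ = 3ν₂ + 4ν₃ + 6ν_∞` is a numerical identity. (For `N = 11, 20, 27, 32, 36` see
  `ModularCurveEtaProductsProofs`.) These discharge the hypothesis of
  `IsNewform0.plusPeriod_pos_of_genus` (`ModularSymbolsManin`) at those levels.

Only theorems; `namespace Literature.ModularForms`.

## References

* Ju. I. Manin, *Parabolic points and zeta functions of modular curves*, Izv. Akad. Nauk SSSR 36
  (1972), Thm. 1.9 (via `ModularSymbolsManin`).
* F. Diamond, J. Shurman, *A first course in modular forms*, GTM 228, Springer (2005), Thm. 3.1.1,
  Thm. 3.5.1, §3.9 Figure 3.3.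
-/

noncomputable section

open scoped MatrixGroups

open CongruenceSubgroup

namespace Literature.NumberTheory.EllipticCurves.ModularForms

variable (N : ℕ) [NeZero N]

/-- **`12 dim S₂(Γ₀(N)) + 3ν₂ + 4ν₃ + 6ν_∞ ≤ 12 + μ` for every `N ≥ 1`** (the `≤` half of
Diamond–Shurman Thm. 3.1.1 with Thm. 3.5.1 for `X₀(N)`), Manin's bound
(`twelve_mul_finrank_cuspForm_two_add_le`) with the closed forms of the counts. [folklore] -/
theorem twelve_mul_finrank_cuspForm_two_add_le_gamma0Index :
    12 * Module.finrank ℂ (CuspForm (Gamma0 N) 2) + 3 * nu₂ N + 4 * nu₃ N + 6 * nuInfty N ≤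
      12 + gamma0Index N := by
  have h := twelve_mul_finrank_cuspForm_two_add_le N
  have h₂ : ellipticPointCount (Gamma0 N) 2 = nu₂ N := ellipticPointCount_two_gamma0_holds N
  have h₃ : ellipticPointCount (Gamma0 N) 3 = nu₃ N := ellipticPointCount_three_gamma0_holds N
  have h₄ : Nat.card (CuspOrbits (Gamma0 N : Subgroup (GL (Fin 2) ℝ))) = nuInfty N :=
    numCusps_eq_nuInfty_holds N
  have h₅ : (Gamma0 N).index = gamma0Index N := index_gamma0_eq_gamma0Index_holds N
  rwa [h₂, h₃, h₄, h₅] at h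

/-- **`dim_ℂ S₂(Γ₀(N)) ≤ g(X₀(N))` for every `N ≥ 1`**, with `g(X₀(N))` the closed formula
`genusX0 N = (12 + μ - 3ν₂ - 4ν₃ - 6ν_∞)/12` (Diamond–Shurman Thm. 3.5.1 gives equality).
[cite: DiamondShurman2005, Thm. 3.5.1] -/
theorem finrank_cuspForm_two_le_genusX0 : Module.finrank ℂ (CuspForm (Gamma0 N) 2) ≤ genusX0 N := by
  have h := twelve_mul_finrank_cuspForm_two_add_le_gamma0Index N
  unfold genusX0
  apply (Nat.le_div_iff_mul_le (by norm_num)).mpr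
  omega

/-- **`dim S₂(Γ₀(N)) = g(X₀(N))` whenever `g(X₀(N)) = 0`**: the named fact
`finrank_cuspForm_two_eq_genusX0 N` for every level with `genusX0 N = 0`.
[cite: DiamondShurman2005, Thm. 3.5.1] -/
theorem finrank_cuspForm_two_eq_genusX0_of_genusX0_eq_zero (hg : genusX0 N = 0) :
    finrank_cuspForm_two_eq_genusX0 N := by
  have h := finrank_cuspForm_two_le_genusX0 N
  unfold finrank_cuspForm_two_eq_genusX0
  omega

/-- **`dim S₂(Γ₀(N)) = g(X₀(N)) = 1` whenever `g(X₀(N)) = 1` and `S₂(Γ₀(N)) ≠ 0`**, and then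
`S₂(Γ₀(N)) = ℂφ` for any nonzero `φ`. [cite: DiamondShurman2005, Thm. 3.5.1] -/
theorem finrank_cuspForm_two_eq_genusX0_of_genusX0_eq_one (hg : genusX0 N = 1)
    {φ : CuspForm (Gamma0 N) 2} (hφ : φ ≠ 0) :
    finrank_cuspForm_two_eq_genusX0 N ∧ ∀ f : CuspForm (Gamma0 N) 2, ∃ c : ℂ, c • φ = f := by
  have hle := finrank_cuspForm_two_le_genusX0 N
  rw [hg] at hle
  have h1 : Module.finrank ℂ (CuspForm (Gamma0 N) 2) = 1 := by
    refine le_antisymm hle ?_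
    rw [Nat.one_le_iff_ne_zero, Ne, finrank_zero_iff_forall_zero, not_forall]
    exact ⟨φ, hφ⟩
  refine ⟨?_, fun f ↦ (finrank_eq_one_iff_of_nonzero' φ hφ).mp h1 f⟩
  unfold finrank_cuspForm_two_eq_genusX0
  rw [h1, hg]

/-- **`dim S₂(Γ₀(13)) = g(X₀(13)) = 0`**: `μ = 14`, `ν_∞ = ν₂ = ν₃ = 2`,
`12 + 14 - 6 - 8 - 12 = 0` (Diamond–Shurman Figure 3.3, §3.1: `X₀(13)` is a sphere).
[cite: DiamondShurman2005, Thm. 3.5.1] -/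
theorem finrank_cuspForm_two_eq_genusX0_thirteen : finrank_cuspForm_two_eq_genusX0 13 := by
  obtain ⟨hμ, hν, h₂, h₃⟩ := gamma0_data_13
  exact finrank_cuspForm_two_eq_genusX0_of_genusX0_eq_zero 13 (by rw [genusX0, hμ, hν, h₂, h₃])

/-- **`dim S₂(Γ₀(N)) = g(X₀(N))` for all `N ≤ 10` and `N = 12, 13, 16, 18, 25`** from Manin's
bound alone (all genus-zero levels; `N = 11` needs a cusp form, `ModularCurveEtaProductsProofs`).
[cite: DiamondShurman2005, Thm. 3.5.1] -/
theorem finrank_cuspForm_two_eq_genusX0_of_mem' {N : ℕ} [NeZero N]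
    (hN : N ∈ ({1, 2, 3, 4, 5, 6, 7, 8, 9, 10, 12, 13, 16, 18, 25} : Finset ℕ)) :
    finrank_cuspForm_two_eq_genusX0 N := by
  simp only [Finset.mem_insert, Finset.mem_singleton] at hN
  rcases hN with rfl | rfl | rfl | rfl | rfl | rfl | rfl | rfl | rfl | rfl | rfl | rfl | rfl |
    rfl | rfl
  · exact finrank_cuspForm_two_eq_genusX0_one
  all_goals first
    | exact finrank_cuspForm_two_eq_genusX0_thirteen
    | exact finrank_cuspForm_two_eq_genusX0_of_mem (by decide)

/-! ### The named fact `twelve_mul_finrank_cuspForm_two (Γ₀(N))` -/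

/-- **What remains of `twelve_mul_finrank_cuspForm_two (Γ₀(N))` is the lower bound**: given
Manin's inequality, the fact is equivalent to `12 + μ ≤ 12 dim S₂(Γ₀(N)) + 3ν₂ + 4ν₃ + 6ν_∞`,
i.e. to `dim S₂(Γ₀(N)) ≥ g(X₀(N))` (existence of enough cusp forms, Riemann–Roch).
[cite: DiamondShurman2005, Thm. 3.5.1 with Thm. 3.1.1] -/
theorem twelve_mul_finrank_cuspForm_two_gamma0_iff_le :
    twelve_mul_finrank_cuspForm_two (Gamma0 N) ↔
      12 + gamma0Index N ≤
        12 * Module.finrank ℂ (CuspForm (Gamma0 N) 2) + 3 * nu₂ N + 4 * nu₃ N + 6 * nuInfty N := by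
  have hle := twelve_mul_finrank_cuspForm_two_add_le_gamma0Index N
  have h₂ : ellipticPointCount (Gamma0 N) 2 = nu₂ N := ellipticPointCount_two_gamma0_holds N
  have h₃ : ellipticPointCount (Gamma0 N) 3 = nu₃ N := ellipticPointCount_three_gamma0_holds N
  have h₄ : Nat.card (CuspOrbits (Gamma0 N : Subgroup (GL (Fin 2) ℝ))) = nuInfty N :=
    numCusps_eq_nuInfty_holds N
  have h₅ : (Gamma0 N).index = gamma0Index N := index_gamma0_eq_gamma0Index_holds N
  unfold twelve_mul_finrank_cuspForm_two
  rw [adjoinNegI_gamma0, h₂, h₃, h₄, h₅]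
  constructor
  · intro h
    exact (h (Gamma0_is_congruence N)).ge
  · intro h _
    exact le_antisymm hle h

/-- **`twelve_mul_finrank_cuspForm_two (Γ₀(N))` from `dim S₂(Γ₀(N)) = genusX0 N` and the
exactness `12 genusX0 N + 3ν₂ + 4ν₃ + 6ν_∞ = 12 + μ`** (both numerical at a given level).
[cite: DiamondShurman2005, Thm. 3.5.1 with Thm. 3.1.1] -/
theorem twelve_mul_finrank_cuspForm_two_gamma0_of (h : finrank_cuspForm_two_eq_genusX0 N)
    (hg : twelve_mul_genusX0 N) : twelve_mul_finrank_cuspForm_two (Gamma0 N) := by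
  rw [twelve_mul_finrank_cuspForm_two_gamma0_iff_le]
  unfold finrank_cuspForm_two_eq_genusX0 at h
  unfold twelve_mul_genusX0 at hg
  rw [h]
  exact hg.ge

/-- `μ(1) = 1`, `ν_∞(1) = 1`, `ν₂(1) = 1`, `ν₃(1) = 1` (level one: one cusp, the elliptic points
`i` and `ρ`). [folklore] -/
theorem gamma0_data_1 : gamma0Index 1 = 1 ∧ nuInfty 1 = 1 ∧ nu₂ 1 = 1 ∧ nu₃ 1 = 1 := by
  refine ⟨by simp [gamma0Index], by decide, ?_, ?_⟩
  · unfold nu₂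
    rw [Nat.card_congr (Equiv.subtypeUnivEquiv fun x ↦ Subsingleton.elim _ _), Nat.card_unique]
  · unfold nu₃
    rw [Nat.card_congr (Equiv.subtypeUnivEquiv fun x ↦ Subsingleton.elim _ _), Nat.card_unique]

/-- **The named fact `twelve_mul_finrank_cuspForm_two (Γ₀(N))` holds for the fifteen genus-zero
levels `N ∈ {1, …, 10, 12, 13, 16, 18, 25}`**: there `dim S₂(Γ₀(N)) = 0` (Manin's bound) and
`3ν₂ + 4ν₃ + 6ν_∞ = 12 + μ` numerically (Diamond–Shurman Figure 3.3). This discharges the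
hypothesis of `IsNewform0.plusPeriod_pos_of_genus` and `isZLattice_periodLattice_of_genus`
(`ModularSymbolsManin`) at these levels. [cite: DiamondShurman2005, Thm. 3.1.1] -/
theorem twelve_mul_finrank_cuspForm_two_gamma0_of_mem {N : ℕ} [NeZero N]
    (hN : N ∈ ({1, 2, 3, 4, 5, 6, 7, 8, 9, 10, 12, 13, 16, 18, 25} : Finset ℕ)) :
    twelve_mul_finrank_cuspForm_two (Gamma0 N) := by
  refine twelve_mul_finrank_cuspForm_two_gamma0_of N (finrank_cuspForm_two_eq_genusX0_of_mem' hN) ?_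
  unfold twelve_mul_genusX0
  simp only [Finset.mem_insert, Finset.mem_singleton] at hN
  rcases hN with rfl | rfl | rfl | rfl | rfl | rfl | rfl | rfl | rfl | rfl | rfl | rfl | rfl |
    rfl | rfl
  · obtain ⟨hμ, hν, h₂, h₃⟩ := gamma0_data_1; rw [genusX0, hμ, hν, h₂, h₃]
  · obtain ⟨hμ, hν, h₂, h₃⟩ := gamma0_data_2; rw [genusX0, hμ, hν, h₂, h₃]
  · obtain ⟨hμ, hν, h₂, h₃⟩ := gamma0_data_3; rw [genusX0, hμ, hν, h₂, h₃]
  · obtain ⟨hμ, hν, h₂, h₃⟩ := gamma0_data_4; rw [genusX0, hμ, hν, h₂, h₃]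
  · obtain ⟨hμ, hν, h₂, h₃⟩ := gamma0_data_5; rw [genusX0, hμ, hν, h₂, h₃]
  · obtain ⟨hμ, hν, h₂, h₃⟩ := gamma0_data_6; rw [genusX0, hμ, hν, h₂, h₃]
  · obtain ⟨hμ, hν, h₂, h₃⟩ := gamma0_data_7; rw [genusX0, hμ, hν, h₂, h₃]
  · obtain ⟨hμ, hν, h₂, h₃⟩ := gamma0_data_8; rw [genusX0, hμ, hν, h₂, h₃]
  · obtain ⟨hμ, hν, h₂, h₃⟩ := gamma0_data_9; rw [genusX0, hμ, hν, h₂, h₃]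
  · obtain ⟨hμ, hν, h₂, h₃⟩ := gamma0_data_10; rw [genusX0, hμ, hν, h₂, h₃]
  · obtain ⟨hμ, hν, h₂, h₃⟩ := gamma0_data_12; rw [genusX0, hμ, hν, h₂, h₃]
  · obtain ⟨hμ, hν, h₂, h₃⟩ := gamma0_data_13; rw [genusX0, hμ, hν, h₂, h₃]
  · obtain ⟨hμ, hν, h₂, h₃⟩ := gamma0_data_16; rw [genusX0, hμ, hν, h₂, h₃]
  · obtain ⟨hμ, hν, h₂, h₃⟩ := gamma0_data_18; rw [genusX0, hμ, hν, h₂, h₃]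
  · obtain ⟨hμ, hν, h₂, h₃⟩ := gamma0_data_25; rw [genusX0, hμ, hν, h₂, h₃]

end Literature.NumberTheory.EllipticCurves.ModularForms

end
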